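import Summits.BirchSwinnertonDyer.BirchSwinnertonDyer.Theorems.EisensteinPrimesB11DescentCertificate
import Summits.BirchSwinnertonDyer.BirchSwinnertonDyer.Theorems.EisensteinPrimesB11L3Cert219b1
import HarnessLib

/-!
# Row B11 per pair, PREPRINT-FREE descent road — display `219b1 @ 3` (SPLIT-notGV window cell, the largest B11 sub-row):
# `BSD(219b1, 3)` from Gross–Zagier–Kolyvagin alone + the two READS (cell `bsd-eis`, seat `bsd-eis-k5-p4` g0; door p536512;
# RULING L76 gate (G3); THEOREMS ONLY — nothing booked)

HONEST FRAMING (cell `bsd-eis`, run/shared/lean/pub/bsd-eis/; row B11 = X2c = `CellC`; crux 4 `BSDpOnCellC` stmt-BirchSwinnertonDyer-19034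
OPEN; no label or count moves; BSD proved for no curve unconditionally). Table row `219b @3` of `pub/bsd-eis/k5-p4-g0/B11-DESC3R1-TABLE-v1.tsv`
(3ba341440843231c): VERDICT `CERT`; record `219b1 = [0, 1, 1, 3, 2]` (`N = 219 = 3·73`, SPLIT multiplicative at `3`, ψ-even), kernel `x`
(`x₀ = 0`), `(s_φ̂, s_φ, m, EXCESS) = (1, 1, 2, 0)` on `isogchi` ‖ `isogcft` IDENTICAL (`m = 2`: rank `1` + the rational kernel point `T = (0, 1)` of
order `3`); member `219b2`: `(1, 1, 2, 0)`; `#Ш_an = 1` on both (Cremona = PARI leg). The split sub-rows of B11 have NO PRE-free booking so far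
(exceptional zero: LM1 / L3 λ-minimal roads are non-split or need `𝓛_p`); the descent road is sign-blind.
**IN THE KERNEL:** `classX2_219b1` (with `isElliptic_219b1`, `isGloballyMinimal_219b1`, the split sign and `E[3]` reducible by the rational `Ψ₃`-root)
IMPORTED BY NAME from k5-p3's L3 display `Theorems/EisensteinPrimesB11L3Cert219b1.lean` (not restated — two PRE-free roads at this pair).
**READ (hypotheses):** `hr`, `hq`/`hv`, `h` as in every display of the road. **PUBLISHED fact BY NAME:** `hGZK` only.
Refs: [Miller2011LMS] Def. 1.1; [SilvermanAEC2009] Ex. 3.7, X.4.2; Cremona `ecdata` class 219b.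
-/

set_option autoImplicit false
set_option linter.dupNamespace false

noncomputable section

open scoped Classical

open WeierstrassCurve Literature.NumberTheory.EllipticCurves
  Literature.NumberTheory.EllipticCurves.Rank1Residual
  Literature.NumberTheory.EllipticCurves.Rank1Residual.Typed
  Summit.BirchSwinnertonDyer.Rank1Residual
  Summit.BirchSwinnertonDyer.Rank1Residual.X2
  Summit.BirchSwinnertonDyer.BirchSwinnertonDyer.Theorems.B11L3Cert219b1
  Summit.BirchSwinnertonDyer.BirchSwinnertonDyer.Theorems.B11DescentCertificate

namespace Summit.BirchSwinnertonDyer.BirchSwinnertonDyer.Theorems.B11Descent219b1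

/-- **X2c INSTANCE, DESCENT ROAD — `BSD(219b1, 3)` at a SPLIT Eisenstein prime** from Gross–Zagier–Kolyvagin (`hGZK`) and the two READS on
`219b1` (`#Ш_an` a `3`-adic unit; `Ш[3] = 0` by the two isogeny-descent engines), through `X2.cellC_bsdp_of_shaAn_unit_of_noPTorsion`. No
`𝓛`-invariant, no exceptional-zero bookkeeping, no Iwasawa input. Nothing booked. [cite: Miller2011LMS, §1 and Def. 1.1] -/
theorem bsdp_219b1_at_three_of_descent (hGZK : rank_eq_analyticRank_of_analyticRank_le_one)
    (W : WeierstrassCurve ℚ) [W.IsElliptic] [W.IsGloballyMinimal] (hW : W = ⟨0, 1, 1, 3, 2⟩)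
    (hr : W.analyticRank = 1) {q : ℚ} (hq : shaAn W = (q : ℂ)) (hv : padicValRat 3 q = 0)
    (h : ∀ x : W.sha, (3 : ℤ) • x = 0 → x = 0) : BSDp W 3 := by
  subst hW
  exact X2.cellC_bsdp_of_shaAn_unit_of_noPTorsion _ 3 hGZK ⟨hr, classX2_219b1⟩ hq hv h

/-- **The same on the route's cell predicate**: `CellC 219b1 3 → BSD(219b1, 3)` modulo GZK and the two reads.
[cite: Miller2011LMS, §1 and Def. 1.1] -/
theorem targetC_219b1_at_three_of_descent (hGZK : rank_eq_analyticRank_of_analyticRank_le_one)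
    (W : WeierstrassCurve ℚ) [W.IsElliptic] [W.IsGloballyMinimal] (hW : W = ⟨0, 1, 1, 3, 2⟩)
    {q : ℚ} (hq : shaAn W = (q : ℂ)) (hv : padicValRat 3 q = 0) (h : ∀ x : W.sha, (3 : ℤ) • x = 0 → x = 0) :
    CellC W 3 → BSDp W 3 :=
  fun hc ↦ bsdp_219b1_at_three_of_descent hGZK W hW hc.1 hq hv h

/-- **DECISION at the pair**: under the descent read `Ш(219b1)[3] = 0`, `BSD(219b1, 3) ↔ ord₃ #Ш_an = 0`.
[cite: Miller2011LMS, §1 and Def. 1.1] -/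
theorem bsdp_219b1_at_three_iff_of_descent (hGZK : rank_eq_analyticRank_of_analyticRank_le_one)
    (W : WeierstrassCurve ℚ) [W.IsElliptic] [W.IsGloballyMinimal] (hW : W = ⟨0, 1, 1, 3, 2⟩)
    (hr : W.analyticRank = 1) (h : ∀ x : W.sha, (3 : ℤ) • x = 0 → x = 0) {q : ℚ} (hq : shaAn W = (q : ℂ)) :
    BSDp W 3 ↔ padicValRat 3 q = 0 := by
  subst hW
  exact X2.cellC_bsdp_iff_padicValRat_shaAn_eq_zero_of_noPTorsion _ 3 hGZK ⟨hr, classX2_219b1⟩ h hq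

end Summit.BirchSwinnertonDyer.BirchSwinnertonDyer.Theorems.B11Descent219b1

end
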